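import Mathlib
import HarnessLib
import Summits.QuantumFields.YangMills.Theorems.PencilRigidityCurvatureKernelBoundFiniteCouplingStrongSubextensive
import Summits.QuantumFields.YangMills.Theorems.PencilRigidityCurvatureKernelBoundInfiniteVolumeCurvatureClusteringR
import Summits.QuantumFields.YangMills.Theorems.PencilRigidityCurvatureKernelBoundTorusFiniteSizeRateR
import Summits.QuantumFields.YangMills.Theorems.PencilRigidityCurvatureKernelBoundTorusInfiniteVolumeComparisonR
import Summits.QuantumFields.YangMills.Theorems.PencilRigidityCurvatureKernelBoundSwapHankelDecayR
import Summits.QuantumFields.YangMills.Theorems.PencilRigidityCurvatureKernelBoundSwapDiagonalVanishingR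
import Summits.QuantumFields.YangMills.Theorems.PencilRigidityCurvatureKernelBoundSwapOffDiagonalVanishingR

/-!
# `CurvatureKernelBound` — child 2b `FiniteCouplingStrongMildlyExtensive`: the FULL strong-coupling disc with renormalisation at
# most MILDLY EXTENSIVE in the lattice size (stub for stmt-QuantumFields-11687, line `coupling-trichotomy`, skeleton v11, lead c11)

Crux `stmt-QuantumFields-11687` (`PencilRigidity.CurvatureKernelBound`). This file PROVES the registered stub
`Stub.FiniteCouplingStrongMildlyExtensive` of skeleton v11: every `W₁`-datum `(r, sch, S₁)` whose couplings converge INTO the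
cluster-expansion disc (`β_k → b`, `|b| < betaOne 4 r.ρ` — the tree's strong-coupling radius itself) and whose plaquette
renormalisation is, frequently in `k` and at non-negative coupling, at most mildly extensive in the lattice size —
`∃ᶠ k, 0 ≤ β_k ∧ log c_k² ≤ θ L_k` for ONE rate `θ` with `e^θ |b| < betaOne` (any `θ` if `b = 0`) — satisfies the conclusion
of the crux (`K ≡ κ²`), UNCONDITIONALLY. It contains lead c10's theorem `FiniteCouplingStrongSubextensive` (p153038: inner disc
`|b| < betaOne/4`, `∀ θ > 0`).

Why the hypothesis relaxes (lead c11): c10's swap-mirror programme consumes the renormalisation rate `c_k² e^{−κ(L_k − T/a_k)} → 0`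
ONLY at `κ = μ′`, the finite-size rate of the Osterwalder–Seiler expansion, and that rate is explicit and β-adaptive: the Schwarz
lemma with multiplicity at radius `r₁ < betaOne` gives `|⟨F⟩^T_{2L+1} − ω_β(F)| ≤ A (β′/r₁)^{L−R}` on `|β| ≤ β′ < r₁`
(`TorusFiniteSizeRateR`), i.e. `μ′ = log (r₁/β′)`, which can be made larger than any `θ` with `e^θ |b| < betaOne` by choosing
`|b| < β′ < r₁ < betaOne` suitably; likewise the infinite-volume limits and the β-uniform clustering hold on the whole open disc
(`InfiniteVolumeCurvatureClusteringR`). Proof = c10's assembly verbatim over the radius-`betaOne` bricks: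
1. subsequence `φ` with `0 ≤ β_{φ j}` and `log c²_{φ j} ≤ θ L_{φ j}` (`Filter.extraction_of_frequently_atTop`), sub-scheme `sch'`;
2. radii `r₁ := (max (e^θ|b|) |b| + betaOne)/2`, `β″ := (|b| + r₁ / max e^θ 1)/2`, rate `μ′ := log (r₁/β″) > θ`, hence
   `c'_k² e^{−μ′ (L'_k − T/a'_k)} → 0` for every `T` (`tendsto_sq_mul_exp_of_log_le_linear`);
3. infinite-volume data (`InfiniteVolumeCurvatureClusteringR`), finite-size rate (`TorusFiniteSizeRateR`), torus ↔ infinite-volume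
   comparison (`TorusInfiniteVolumeComparisonR`);
4. signed swap-Hankel decay (`SwapHankelDecayR`) ⇒ vanishing on mirror pairs (`SwapDiagonalVanishingR`) ⇒ on mirror-separated
   pairs (`SwapOffDiagonalVanishingR`) ⇒ factorisation on all axial ball pairs (`axial_ball_halfspace`) ⇒ c9's endgame
   (`exists_degreeOne_eq_const_mul_realIntegral`, `KernelConclusionOfWitnessLocalDecay`, `η = 10`).
[OsterwalderSeiler1978 Thm. 3.5–3.7; FrohlichIsraelLiebSimon1978 Thm. 2.1; OsterwalderSchrader1973 §4.1; folklore]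
-/

noncomputable section

open scoped BigOperators Topology SchwartzMap
open MeasureTheory Filter Set Metric
open Literature.MathematicalPhysics.QuantumLattice Literature.MathematicalPhysics.AQFT
  Literature.MathematicalPhysics.QuantumFieldTheory

namespace Summit.QuantumFields.YangMills.Theorems.CurvatureKernel

/-- **The mildly-extensive rate.** If `0 < a_k`, `a_k → 0`, `a_k L_k → ∞`, `log c_k² ≤ θ L_k` for all `k` and `θ < μ`,
then `c_k² e^{−μ (L_k − T / a_k)} → 0` for every `T`. [folklore] -/
theorem tendsto_sq_mul_exp_of_log_le_linear (a c : ℕ → ℝ) (L : ℕ → ℕ) (θ μ : ℝ) (ha : ∀ k, 0 < a k)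
    (ha0 : Tendsto a atTop (𝓝 0)) (haL : Tendsto (fun k => a k * L k) atTop atTop)
    (hlog : ∀ k, Real.log (c k ^ 2) ≤ θ * (L k : ℝ)) (hθμ : θ < μ) (T : ℝ) :
    Tendsto (fun k => c k ^ 2 * Real.exp (-(μ * ((L k : ℝ) - T / a k)))) atTop (𝓝 0) := by
  -- the exponent `θ L - μ (L - T/a) = -( (1/a) * (a L (μ - θ) - μ T) )` tends to `-∞`
  have hexp : Tendsto (fun k : ℕ => θ * (L k : ℝ) - μ * ((L k : ℝ) - T / a k)) atTop atBot := by
    have h2 : Tendsto (fun k : ℕ => a k * L k * (μ - θ)) atTop atTop :=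
      haL.atTop_mul_const (sub_pos.2 hθμ)
    have h3 : Tendsto (fun k : ℕ => a k * L k * (μ - θ) - μ * T) atTop atTop :=
      tendsto_atTop_add_const_right _ _ h2
    have h4 : Tendsto (fun k : ℕ => (a k)⁻¹) atTop atTop := by
      have : Tendsto a atTop (𝓝[>] 0) :=
        tendsto_nhdsWithin_iff.2 ⟨ha0, Eventually.of_forall fun k => ha k⟩
      exact tendsto_inv_nhdsGT_zero.comp this
    have h5 : Tendsto (fun k : ℕ => (a k)⁻¹ * (a k * L k * (μ - θ) - μ * T)) atTop atTop :=
      h4.atTop_mul_atTop₀ h3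
    have h6 := tendsto_neg_atTop_atBot.comp h5
    refine h6.congr fun k => ?_
    have hak : (a k) ≠ 0 := (ha k).ne'
    simp only [Function.comp_apply]
    field_simp
    ring
  have hE : Tendsto (fun k : ℕ => Real.exp (θ * (L k : ℝ) - μ * ((L k : ℝ) - T / a k))) atTop (𝓝 0) :=
    Real.tendsto_exp_atBot.comp hexp
  -- squeeze: `0 ≤ c² e^{…} ≤ e^{θ L} e^{…}`
  refine squeeze_zero (fun k => by positivity) (fun k => ?_) hE
  have hc : c k ^ 2 ≤ Real.exp (Real.log (c k ^ 2)) := by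
    by_cases h0 : c k ^ 2 = 0
    · rw [h0]; exact (Real.exp_pos _).le
    · rw [Real.exp_log (lt_of_le_of_ne (sq_nonneg _) (Ne.symm h0))]
  calc c k ^ 2 * Real.exp (-(μ * ((L k : ℝ) - T / a k)))
      ≤ Real.exp (θ * (L k : ℝ)) * Real.exp (-(μ * ((L k : ℝ) - T / a k))) := by
        refine mul_le_mul_of_nonneg_right (hc.trans (Real.exp_le_exp.2 (hlog k))) (Real.exp_pos _).le
    _ = Real.exp (θ * (L k : ℝ) - μ * ((L k : ℝ) - T / a k)) := by
        rw [← Real.exp_add]; ring_nf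

/-- **The radii of the mildly-extensive class.** For `|b| < β₁`, `e^θ |b| < β₁` there are `0 < β″ < r₁ < β₁` with
`|b| < β″` and `e^θ β″ < r₁`, i.e. `θ < log (r₁/β″)` — the finite-size rate at radius `r₁` on the closed coupling disc `β″`
beats the renormalisation rate `θ`. [folklore] -/
theorem exists_radii_of_exp_mul_lt {b β₁ θ : ℝ} (hb : |b| < β₁) (hθ : Real.exp θ * |b| < β₁) :
    ∃ β'' r₁ : ℝ, 0 < β'' ∧ |b| < β'' ∧ β'' < r₁ ∧ r₁ < β₁ ∧ θ < Real.log (r₁ / β'') := by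
  set b0 : ℝ := |b| with hb0def
  have hb0 : 0 ≤ b0 := abs_nonneg b
  set E : ℝ := Real.exp θ with hEdef
  have hE : 0 < E := Real.exp_pos θ
  set Mx : ℝ := max (E * b0) b0 with hMxdef
  have hMx : Mx < β₁ := max_lt hθ hb
  set r₁ : ℝ := (Mx + β₁) / 2 with hr₁def
  have hMr : Mx < r₁ := by rw [hr₁def]; linarith
  have hr1 : r₁ < β₁ := by rw [hr₁def]; linarith
  have hr0 : 0 < r₁ := lt_of_le_of_lt (hb0.trans (le_max_right _ _)) hMr
  set D : ℝ := max E 1 with hDdef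
  have hD1 : 1 ≤ D := le_max_right _ _
  have hD0 : 0 < D := one_pos.trans_le hD1
  have hbD : b0 * D = Mx := by
    rw [hDdef, mul_max_of_nonneg _ _ hb0, mul_one, mul_comm, hMxdef]
  have hb0lt : b0 < r₁ / D := by
    rw [lt_div_iff₀ hD0, hbD]; exact hMr
  set β'' : ℝ := (b0 + r₁ / D) / 2 with hβ''def
  have h1 : b0 < β'' := by rw [hβ''def]; linarith
  have h2 : β'' < r₁ / D := by rw [hβ''def]; linarith
  have hβ''0 : 0 < β'' := lt_of_le_of_lt hb0 h1
  have h3 : β'' * D < r₁ := (lt_div_iff₀ hD0).1 h2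
  have h4 : β'' < r₁ := by
    have : β'' ≤ β'' * D := le_mul_of_one_le_right hβ''0.le hD1
    exact lt_of_le_of_lt this h3
  have h5 : E * β'' < r₁ := by
    have : E * β'' ≤ β'' * D := by rw [mul_comm]; exact mul_le_mul_of_nonneg_left (le_max_left _ _) hβ''0.le
    exact lt_of_le_of_lt this h3
  refine ⟨β'', r₁, hβ''0, h1, h4, hr1, ?_⟩
  rw [Real.lt_log_iff_exp_lt (div_pos hr0 hβ''0), lt_div_iff₀ hβ''0]
  exact h5

open SemiDegenerate BoundedRenormalisation in
/-- **Stub `FiniteCouplingStrongMildlyExtensive`** (child 2b of skeleton v11, registered signature verbatim): on the full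
cluster-expansion disc `|b| < betaOne 4 r.ρ`, every `W₁`-datum whose plaquette renormalisation is at most mildly extensive in
the lattice size at non-negative coupling (`∃ᶠ k, 0 ≤ β_k ∧ log c_k² ≤ θ L_k`, `e^θ |b| < betaOne`) satisfies the conclusion of
the crux. See the module docstring for the proof (lead c10's swap-mirror programme over lead c11's radius-`betaOne` bricks). [folklore] -/
theorem FiniteCouplingStrongMildlyExtensive : open Literature.MathematicalPhysics.QuantumLattice Literature.MathematicalPhysics.AQFT Literature.MathematicalPhysics.QuantumFieldTheory in ∀ (G : Type) [Group G] [TopologicalSpace G] [IsTopologicalGroup G] [CompactSpace G] [MeasurableSpace G] [BorelSpace G], IsCompactSimpleLieGroup G → ∀ (r : LatticeRep G) (sch : SpeciesScheme (YMSpecies G)) (S₁ : SchwingerFamily (EuclideanSpace ℝ (Fin 4))), ((∀ (n : ℕ), n ≠ 0 → ∀ (f : Fin n → SchwartzMap ((EuclideanSpace ℝ (Fin 4))) ℝ) (F : SchwartzMap (Fin n → (EuclideanSpace ℝ (Fin 4))) ℂ), IsTensorOf F (fun i => ofRealTest (f i)) → IsOffDiagonal F → Filter.Tendsto (fun k : ℕ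 => ((latticeSchwinger r.ρ sch (fun s => s.F) k n (fun _ => r.curvature) f : ℝ) : ℂ)) Filter.atTop (nhds (S₁ n F))) ∧ (S₁.toLabelled.IsNormalized ∧ S₁.toLabelled.IsHermitian ∧ S₁.toLabelled.HasLinearGrowth ∧ S₁.toLabelled.IsReflectionPositive ∧ S₁.toLabelled.IsSymmetric ∧ S₁.toLabelled.HasClusterProperty) ∧ (∀ (n : ℕ) (a : (EuclideanSpace ℝ (Fin 4))) (F : SchwartzMap (Fin n → (EuclideanSpace ℝ (Fin 4))) ℂ), IsOffDiagonal F → S₁ n (translateMulti a F) = S₁ n F) ∧ (∀ (R : (EuclideanSpace ℝ (Fin 4)) ≃ₗᵢ[ℝ] (EuclideanSpace ℝ (Fin 4))), LinearMap.det (R.toLinearEquiv : (EuclideanSpace ℝ (Fin 4)) →ₗ[ℝ] (EuclideanSpace ℝ (Fin 4))) = 1 → (∀ i : Fin 4, ∃ j : Fin 4, R (EuclideanSpace.single i 1) = EuclideanSpace.single j 1 ∨ R (EuclideanSpace.single i 1) = -EuclideanSpace.single j 1) → ∀ (n : ℕ) (F : SchwartzMap (Fin n → (EuclideanSpace ℝ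 (Fin 4))) ℂ), IsOffDiagonal F → S₁ n (linActMulti R F) = S₁ n F) ∧ (∃ Δ : ℝ, 0 < Δ ∧ S₁.toLabelled.HasMassGap Δ ∧ HasLatticeMassGap r sch Δ)) → ∀ b : ℝ, Filter.Tendsto sch.β Filter.atTop (nhds b) → |b| < betaOne 4 r.ρ → ∀ θ : ℝ, Real.exp θ * |b| < betaOne 4 r.ρ → (∃ᶠ k in Filter.atTop, 0 ≤ sch.β k ∧ Real.log (sch.c r.curvature k ^ 2) ≤ θ * sch.L k) → ∃ (K : (EuclideanSpace ℝ (Fin 4)) → ℝ) (C η : ℝ), 0 < η ∧ ContinuousOn K {x : (EuclideanSpace ℝ (Fin 4)) | x ≠ 0} ∧ (∀ x : (EuclideanSpace ℝ (Fin 4)), x ≠ 0 → |K x| ≤ C * (1 + ‖x‖ ^ (η - 10))) ∧ ∀ F : SchwartzMap (Fin 2 → (EuclideanSpace ℝ (Fin 4))) ℂ, IsOffDiagonal F → MeasureTheory.Integrable (fun x : Fin 2 → (EuclideanSpace ℝ (Fin 4)) => (K (x 0 - x 1) : ℂ) * F x) ∧ S₁ 2 F = ∫ x : Fin 2 → (EuclideanSpace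 ℝ (Fin 4)), (K (x 0 - x 1) : ℂ) * F x := by
  intro G _ _ _ _ _ _ hG r sch S₁ hW₁ b hb hbabs θ hθ hfreq
  haveI : T2Space G := (r.continuous.isClosedEmbedding r.injective).isEmbedding.t2Space
  haveI : SecondCountableTopology G :=
    (r.continuous.isClosedEmbedding r.injective).isEmbedding.secondCountableTopology
  -- (1) the subsequence: `0 ≤ β_{φ j}` and `log c²_{φ j} ≤ θ L_{φ j}`
  obtain ⟨φ, hφ, hφP⟩ := Filter.extraction_of_frequently_atTop hfreq
  obtain ⟨sch', hls, hβ', ha', hc', hL', hgap'⟩ := exists_subseqScheme_withL r sch φ hφ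
  obtain ⟨hconv, hpkg, htr, hhyp, Δ, hΔ, hgap, hlat⟩ := id hW₁
  have hconv' : ∀ (n : ℕ), n ≠ 0 → ∀ (f : Fin n → 𝓢(EuclideanSpace ℝ (Fin 4), ℝ))
      (F : 𝓢((Fin n → EuclideanSpace ℝ (Fin 4)), ℂ)), IsTensorOf F (fun i => ofRealTest (f i)) → IsOffDiagonal F →
      Tendsto (fun k : ℕ => ((latticeSchwinger r.ρ sch' (fun s => s.F) k n (fun _ => r.curvature) f : ℝ) : ℂ))
        atTop (𝓝 (S₁ n F)) := by
    intro n hn f F hF hoff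
    refine ((hconv n hn f F hF hoff).comp hφ.tendsto_atTop).congr (fun k => ?_)
    simp only [Function.comp_apply, hls]
  -- the scheme data of `sch'`
  have h0' : ∀ k, 0 ≤ sch'.β k := fun k => by rw [hβ']; exact (hφP k).1
  have hlog' : ∀ k, Real.log (sch'.c r.curvature k ^ 2) ≤ θ * (sch'.L k : ℝ) := fun k => by
    rw [hc', hL']; exact (hφP k).2
  -- (2) the radii `|b| < β″ < r₁ < betaOne`, `θ < μ′ := log (r₁/β″)`
  obtain ⟨β'', r₁, hβ''0, hbβ'', hβ''r, hr1, hθμ⟩ := exists_radii_of_exp_mul_lt hbabs hθ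
  have hβ''1 : β'' < betaOne 4 r.ρ := hβ''r.trans hr1
  have hμ' : 0 < Real.log (r₁ / β'') := Real.log_pos ((one_lt_div hβ''0).2 hβ''r)
  have hev : ∀ᶠ k in atTop, sch'.β k ≤ β'' := by
    have h1 : Tendsto sch'.β atTop (𝓝 b) := by rw [hβ']; exact hb.comp hφ.tendsto_atTop
    exact (h1.eventually (Iic_mem_nhds ((le_abs_self b).trans_lt hbβ''))).mono fun k hk => hk
  -- the renormalisation rate along `sch'` AT the finite-size rate
  have hrate : ∀ T : ℝ, Tendsto (fun k : ℕ => sch'.c r.curvature k ^ 2 *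
      Real.exp (-(Real.log (r₁ / β'') * ((sch'.L k : ℝ) - T / sch'.a k)))) atTop (𝓝 0) := fun T =>
    tendsto_sq_mul_exp_of_log_le_linear sch'.a (sch'.c r.curvature) sch'.L θ (Real.log (r₁ / β'')) sch'.a_pos
      sch'.tendsto_a sch'.tendsto_L hlog' hθμ T
  -- (3) infinite-volume data, the finite-size rate and the torus ↔ infinite-volume comparison
  obtain ⟨m, A, q, P, hm, hF5⟩ := InfiniteVolumeCurvatureClusteringR r.N G r.ρ r.continuous r.curvature.F
    ⟨_, r.curvature.isCylinder⟩ r.curvature.measurable r.curvature.bounded β'' hβ''0 hβ''1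
  have hAfs := TorusFiniteSizeRateR r.N G r.ρ r.continuous β'' r₁ hβ''0 hβ''r hr1
  choose Afs hAfs using hAfs
  obtain ⟨K, hK⟩ := TorusInfiniteVolumeComparisonR G r sch' β'' (Real.log (r₁ / β'')) Afs hμ' hAfs
  -- (4) vanishing on mirror pairs (signed decay from `SwapHankelDecayR`, endgame `SwapDiagonalVanishingR`)
  have hA : ∀ (δ T : ℝ) (g gθ : 𝓢(EuclideanSpace ℝ (Fin 4), ℝ)), 0 < δ → 0 < T →
      (∀ z ∈ tsupport (g : EuclideanSpace ℝ (Fin 4) → ℝ), δ ≤ z 0 - z 1) →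
      tsupport (g : EuclideanSpace ℝ (Fin 4) → ℝ) ⊆ closedBall 0 T →
      (∀ z : EuclideanSpace ℝ (Fin 4), gθ z = g (WithLp.toLp 2 (fun i => z (Equiv.swap (0 : Fin 4) 1 i)))) →
      Tendsto (fun k : ℕ => latticeSchwinger r.ρ sch' (fun s => s.F) k 2 (fun _ => r.curvature) ![gθ, g] -
        latticeSchwinger r.ρ sch' (fun s => s.F) k 1 (fun _ => r.curvature) (fun _ => gθ) *
          latticeSchwinger r.ρ sch' (fun s => s.F) k 1 (fun _ => r.curvature) (fun _ => g)) atTop (𝓝 0) := by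
    intro δ T g gθ hδ hT hg hgT hθg
    refine SwapDiagonalVanishingR G r sch' S₁ hconv' β'' hβ''0 hβ''1 h0' hev m A q P hm hF5 (Real.log (r₁ / β'')) K
      hμ' hrate hK δ T g gθ hδ hT hg hgT hθg ?_
    have hea : ∀ᶠ k in atTop, sch'.a k ≤ δ := sch'.tendsto_a.eventually (Iic_mem_nhds hδ)
    filter_upwards [hev, hea] with k hk hka u
    exact SwapHankelDecayR G r β'' m A q P hβ''0 hβ''1 hm hF5 (sch'.β k) (h0' k) hk (sch'.L k) (sch'.a k) δ
      (sch'.a_pos k) hka g gθ hg hθg u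
  -- (5) vanishing on mirror-separated pairs (`SwapOffDiagonalVanishingR`), hence factorisation on ALL axial ball pairs
  have hB := SwapOffDiagonalVanishingR G r sch' β'' hβ''0 hβ''1 h0' hev m A q P hm hF5 (Real.log (r₁ / β'')) K hμ'
    hrate hK hA
  have hfar : ∀ (s ρ : ℝ), 0 < s → 0 < ρ → ρ ≤ s / 2 →
      ∀ (f : Fin 2 → 𝓢(EuclideanSpace ℝ (Fin 4), ℝ)) (F : 𝓢((Fin 2 → EuclideanSpace ℝ (Fin 4)), ℂ))
        (F₀ F₁ : 𝓢((Fin 1 → EuclideanSpace ℝ (Fin 4)), ℂ)), IsTensorOf F (fun i => ofRealTest (f i)) →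
        IsTensorOf F₀ (fun _ => ofRealTest (f 0)) → IsTensorOf F₁ (fun _ => ofRealTest (f 1)) →
        tsupport ((f 0 : 𝓢(EuclideanSpace ℝ (Fin 4), ℝ)) : EuclideanSpace ℝ (Fin 4) → ℝ) ⊆
          closedBall (EuclideanSpace.single (0 : Fin 4) (-s)) ρ →
        tsupport ((f 1 : 𝓢(EuclideanSpace ℝ (Fin 4), ℝ)) : EuclideanSpace ℝ (Fin 4) → ℝ) ⊆
          closedBall (EuclideanSpace.single (0 : Fin 4) s) ρ →
        S₁ 2 F = S₁ 1 F₀ * S₁ 1 F₁ := by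
    intro s ρ hs hρ hρs f F F₀ F₁ hF hF₀ hF₁ h0 h1
    obtain ⟨hδ, hpos, hneg, hballp, hballm⟩ := axial_ball_halfspace hs hρ hρs
    have hsρ : 0 < s + ρ := by linarith
    have ht := hB (s - Real.sqrt 2 * ρ) (s + ρ) (f 0) (f 1) hδ hsρ (fun z hz => hneg z (h0 hz))
      (fun z hz => hpos z (h1 hz)) (h0.trans hballm) (h1.trans hballp)
    have hf : ![f 0, f 1] = f := by
      funext i; fin_cases i <;> rfl
    rw [hf] at ht
    have hFoff : IsOffDiagonal F :=
      isOffDiagonal_of_isTensorOf_of_disjoint hF ((disjoint_closedBall_single hs hρs).mono h0 h1)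
    have hu := hconv' 2 two_ne_zero f F hF hFoff
    have hv := hconv' 1 one_ne_zero (fun _ => f 0) F₀ hF₀ (HypercubicLimit.Negative.isOffDiagonal_fin_one F₀)
    have hw := hconv' 1 one_ne_zero (fun _ => f 1) F₁ hF₁ (HypercubicLimit.Negative.isOffDiagonal_fin_one F₁)
    have ht' : Tendsto (fun k : ℕ =>
        ((latticeSchwinger r.ρ sch' (fun s => s.F) k 2 (fun _ => r.curvature) f : ℝ) : ℂ) -
          ((latticeSchwinger r.ρ sch' (fun s => s.F) k 1 (fun _ => r.curvature) (fun _ => f 0) : ℝ) : ℂ) *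
            ((latticeSchwinger r.ρ sch' (fun s => s.F) k 1 (fun _ => r.curvature) (fun _ => f 1) : ℝ) : ℂ))
        atTop (𝓝 0) := by
      have h := (Complex.continuous_ofReal.tendsto 0).comp ht
      rw [Complex.ofReal_zero] at h
      refine h.congr fun k => ?_
      simp only [Function.comp_apply, Complex.ofReal_sub, Complex.ofReal_mul]
    have hZ : S₁ 2 F - S₁ 1 F₀ * S₁ 1 F₁ = 0 := tendsto_nhds_unique (hu.sub (hv.mul hw)) ht'
    exact sub_eq_zero.1 hZ
  -- (6) two-point LOCAL DECAY with `η = 10`, `A = ‖κ‖²`, `B = 0`, and the kernel conclusion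
  obtain ⟨κ, hκ⟩ := exists_degreeOne_eq_const_mul_realIntegral S₁ htr
  refine KernelConclusionOfWitnessLocalDecay G hG r sch S₁ hW₁ ⟨‖κ‖ ^ 2, 10, 1, by norm_num, one_pos, ?_⟩
  intro s hs _
  refine ⟨s / 2, ‖κ‖ ^ 2, 0, half_pos hs, sq_nonneg _, le_rfl, ?_, ?_⟩
  · rw [sub_self, Real.rpow_zero, mul_one, add_zero]
  · intro ρ hρ hρs f F M₀ M₁ hF h0 h1 _ _
    obtain ⟨F₀, hF₀⟩ := exists_isTensorOf (n := 1) (fun _ : Fin 1 => ofRealTest (f 0))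
    obtain ⟨F₁, hF₁⟩ := exists_isTensorOf (n := 1) (fun _ : Fin 1 => ofRealTest (f 1))
    have hZ := hfar s ρ hs hρ hρs f F F₀ F₁ hF hF₀ hF₁ h0 h1
    rw [hZ, hκ (f 0) F₀ hF₀, hκ (f 1) F₁ hF₁]
    calc ‖κ * ((∫ x : EuclideanSpace ℝ (Fin 4), f 0 x : ℝ) : ℂ) *
          (κ * ((∫ x : EuclideanSpace ℝ (Fin 4), f 1 x : ℝ) : ℂ))‖
        ≤ ‖κ‖ ^ 2 * (∫ x : EuclideanSpace ℝ (Fin 4), |f 0 x|) * (∫ x : EuclideanSpace ℝ (Fin 4), |f 1 x|) :=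
          norm_disconnected_le κ f
      _ = ‖κ‖ ^ 2 * (∫ x : EuclideanSpace ℝ (Fin 4), |f 0 x|) * (∫ x : EuclideanSpace ℝ (Fin 4), |f 1 x|) +
          0 * ρ ^ 8 * M₀ * M₁ := by ring

end Summit.QuantumFields.YangMills.Theorems.CurvatureKernel

end
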